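import Summits.ValiantsHypothesis.ValiantsHypothesis.Theorems.DepthWindowDualityMonomials
import HarnessLib

/-!
# Route `DepthWindow`, g17 — duality halving IV: the invariant, the easy cases, the budget

Fourth of five files proving `DualityHalving` (`Theorems/DepthWindowDualityHalvingProof.lean`).
The halving induction keeps, after the first `m` gates of `D`, an accumulator `Acc` of new gates and
operands `O i` (`i < m`) referring into it, with `O i` computing `tv i` at product level
`≤ ⌈gatePD i / 2⌉`.  Here: operand-level semantics and support of the symbolic circuit
(`aeval_symC_opVal`, `support_symC_opVal_subset`); the one-gate extension of the invariant
(`inv_extend`: earlier operands keep value and level in an extended accumulator); the three easy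
cases of a gate — constant truncated value (`step_const`), a sum gate (`step_sum`, copied with
re-mapped operands, level `max ≤ ⌈·/2⌉`), a product gate whose operands have EVEN maximal level `M`
(`step_prod_even`, copied: `1 + ⌈(M+1)/2⌉ = ⌈(M+2)/2⌉`); and the budget arithmetic: one duality block
has `blockSize u d + 2 ≤ perGate N d = 16 N² 64^d` gates for `u ≤ 2N` atom monomials
(`blockSize_succ_le`), and `s · perGate N d ≤ N^8 2^{8d}` (`total_le`).
[cite: GuptaKamathKayalSaptharishi2016, §4] [cite: Burgisser2000, Def. 2.1] [cite: LST2021, §2]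
-/

-- layout Summits/ValiantsHypothesis/ValiantsHypothesis forces the duplicated namespace component
set_option linter.dupNamespace false

namespace Summit.ValiantsHypothesis.ValiantsHypothesis.Theorems.DepthWindow

open MvPolynomial Literature.Computability.AlgebraicComplexity ArithCircuit
open Literature.Computability.AlgebraicComplexity.DepthReduction
open Literature.Computability.AlgebraicComplexity.DepthThreeChasm

section Halving

variable {σ : Type*} (d : ℕ) (D : ArithCircuit ℂ σ)

variable {D} in
/-- Operand-level semantics of the symbolic circuit. [cite: GuptaKamathKayalSaptharishi2016, §4] -/
theorem aeval_symC_opVal (hd : 1 ≤ d) (h : ∀ g ∈ gateValues D.gates, ∃ e : ℕ, g.IsHomogeneous e)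
    (L m : ℕ) (Θ : Fin D.size ⊕ σ → MvPolynomial σ ℂ) (hΘv : ∀ t, Θ (Sum.inr t) = X t)
    (hΘa : ∀ j : Fin D.size, (j : ℕ) < m → (tv d D j).totalDegree ≠ 0 → D.gatePD j ≤ L →
      Θ (Sum.inl j) = tv d D j) :
    ∀ u : Operand ℂ σ, aeval Θ ((symC d D L).opVal m (u.rename Sum.inr)) = trunc d (D.opVal m u)
  | .var t => by rw [Operand.rename, opVal_var, aeval_X, hΘv, opVal_var, trunc_X hd]
  | .const c => by rw [Operand.rename, opVal_const, algHom_C, algebraMap_eq, opVal_const, trunc_C]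
  | .gate j => by
      rw [Operand.rename, opVal_gate, opVal_gate]
      split_ifs with hj
      · rw [aeval_symC_gateVal d hd h L m Θ hΘv hΘa j hj, tv_def]
      · rw [map_zero, map_zero]

variable {D} in
/-- Operand-level support bound. [cite: GuptaKamathKayalSaptharishi2016, Lemma 4.4] -/
theorem support_symC_opVal_subset [Fintype σ] [DecidableEq σ] (L i : ℕ) :
    ∀ u : Operand ℂ σ, D.opPD i u ≤ L + 1 →
      ((symC d D L).opVal i (u.rename Sum.inr)).support ⊆ atomSupport d D
  | .var t, _ => by
      rw [Operand.rename, opVal_var]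
      exact support_monomial_subset.trans
        (Finset.singleton_subset_iff.2 (single_mem_atomSupport d D _))
  | .const c, _ => by
      rw [Operand.rename, opVal_const, C_apply]
      exact support_monomial_subset.trans (Finset.singleton_subset_iff.2 (zero_mem_atomSupport d D))
  | .gate j, hu => by
      rw [Operand.rename, opVal_gate]
      rw [opPD_gate] at hu
      split_ifs at hu ⊢ with hj
      · exact support_symC_gateVal_subset d L j hu
      · simp

omit d D in
/-- `RefsBelow` is monotone in the bound. [cite: Burgisser2000, Def. 2.1] -/
theorem refsBelow_mono {n n' : ℕ} (hn : n ≤ n') :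
    ∀ {u : Operand ℂ σ}, u.RefsBelow n → u.RefsBelow n'
  | .var _, _ => trivial
  | .const _, _ => trivial
  | .gate _, h => lt_of_lt_of_le h hn

/-! #### The invariant of the halving induction and its one-gate extension -/

variable {d D}

/-- Extending the invariant by one gate of `D`: the earlier operands keep their meaning in the
extended accumulator, the new operand `new` represents gate `m`. [cite: Burgisser2000, Def. 2.1] -/
theorem inv_extend {m : ℕ} {Acc T : List (Gate ℂ σ)} {O : ℕ → Operand ℂ σ} {new : Operand ℂ σ}
    (h1 : ∀ i < m, (O i).RefsBelow Acc.length)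
    (h2 : ∀ i < m, (O i).eval (gateValues Acc) = tv d D i)
    (h3 : ∀ i < m, (O i).depthIn (gateWDepths prodWeight Acc) ≤ (D.gatePD i + 1) / 2)
    (n1 : new.RefsBelow (Acc ++ T).length) (n2 : new.eval (gateValues (Acc ++ T)) = tv d D m)
    (n3 : new.depthIn (gateWDepths prodWeight (Acc ++ T)) ≤ (D.gatePD m + 1) / 2) :
    ∃ O' : ℕ → Operand ℂ σ,
      (∀ i < m + 1, (O' i).RefsBelow (Acc ++ T).length) ∧
      (∀ i < m + 1, (O' i).eval (gateValues (Acc ++ T)) = tv d D i) ∧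
      (∀ i < m + 1, (O' i).depthIn (gateWDepths prodWeight (Acc ++ T)) ≤ (D.gatePD i + 1) / 2) := by
  obtain ⟨X, hX, -⟩ := gateValues_prefix Acc T
  obtain ⟨Y, hY, -⟩ := gateWDepths_prefix prodWeight Acc T
  have hVA : (gateValues Acc).length = Acc.length := gateValues_length Acc
  have hDA : (gateWDepths prodWeight Acc).length = Acc.length := gateWDepths_length _ _
  refine ⟨fun i => if i = m then new else O i, fun i hi => ?_, fun i hi => ?_, fun i hi => ?_⟩
  · dsimp only
    by_cases him : i = m
    · rw [if_pos him]; exact n1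
    · rw [if_neg him]
      exact refsBelow_mono (by simp) (h1 i (by omega))
  · dsimp only
    by_cases him : i = m
    · rw [if_pos him, him]; exact n2
    · rw [if_neg him, hX, operand_eval_append_of_refsBelow _ _ (by rw [hVA]; exact h1 i (by omega))]
      exact h2 i (by omega)
  · dsimp only
    by_cases him : i = m
    · rw [if_pos him, him]; exact n3
    · rw [if_neg him, hY, depthIn_append_of_refsBelow _ _ (by rw [hDA]; exact h1 i (by omega))]
      exact h3 i (by omega)

/-- Reading the last gate of `Acc ++ [g]`: value. [cite: Burgisser2000, Def. 2.1] -/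
theorem eval_gate_last (Acc : List (Gate ℂ σ)) (g : Gate ℂ σ) :
    (Operand.gate Acc.length : Operand ℂ σ).eval (gateValues (Acc ++ [g])) =
      g.eval (gateValues Acc) := by
  have hVA : (gateValues Acc).length = Acc.length := gateValues_length Acc
  rw [Operand.eval, gateValues_append_singleton, List.getD_append_right _ _ _ _ hVA.le, hVA,
    Nat.sub_self, List.getD_cons_zero]

/-- Reading the last gate of `Acc ++ [g]`: depth. [cite: LST2021, §2] -/
theorem depthIn_gate_last (Acc : List (Gate ℂ σ)) (g : Gate ℂ σ) :
    (Operand.gate Acc.length : Operand ℂ σ).depthIn (gateWDepths prodWeight (Acc ++ [g])) =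
      prodWeight g + (g.args.map (Operand.depthIn (gateWDepths prodWeight Acc))).foldr max 0 := by
  have hDA : (gateWDepths prodWeight Acc).length = Acc.length := gateWDepths_length _ _
  rw [Operand.depthIn, gateWDepths_append_singleton, List.getD_append_right _ _ _ _ hDA.le, hDA,
    Nat.sub_self, List.getD_cons_zero]

/-! #### The four cases of one gate -/

/-- Case (a): a gate with constant truncated value is represented by that constant. -/
theorem step_const {m : ℕ} (Acc : List (Gate ℂ σ)) (hk : (tv d D m).totalDegree = 0) :
    ∃ (T : List (Gate ℂ σ)) (new : Operand ℂ σ), new.RefsBelow (Acc ++ T).length ∧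
      new.eval (gateValues (Acc ++ T)) = tv d D m ∧
      new.depthIn (gateWDepths prodWeight (Acc ++ T)) ≤ (D.gatePD m + 1) / 2 ∧ T.length ≤ 1 := by
  refine ⟨[], .const (coeff 0 (tv d D m)), trivial, ?_, by simp [Operand.depthIn], by simp⟩
  rw [Operand.eval, ← tv_eq_C d D hk]

/-- Case (b): a sum gate is copied with re-mapped operands. [cite: GuptaKamathKayalSaptharishi2016, §4] -/
theorem step_sum (hd : 1 ≤ d) {m : ℕ} {args : List (ℂ × Operand ℂ σ)}
    (hg : D.gates[m]? = some (.sum args)) (Acc : List (Gate ℂ σ)) (O : ℕ → Operand ℂ σ)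
    (h2 : ∀ i < m, (O i).eval (gateValues Acc) = tv d D i)
    (h3 : ∀ i < m, (O i).depthIn (gateWDepths prodWeight Acc) ≤ (D.gatePD i + 1) / 2) :
    ∃ (T : List (Gate ℂ σ)) (new : Operand ℂ σ), new.RefsBelow (Acc ++ T).length ∧
      new.eval (gateValues (Acc ++ T)) = tv d D m ∧
      new.depthIn (gateWDepths prodWeight (Acc ++ T)) ≤ (D.gatePD m + 1) / 2 ∧ T.length ≤ 1 := by
  refine ⟨[Gate.sum (args.map fun a => (a.1, remap O m a.2))], .gate Acc.length,
    by simp [Operand.RefsBelow], ?_, ?_, by simp⟩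
  · rw [eval_gate_last, Gate.eval, List.map_map, tv_def, gateVal_of_sum D hg, map_list_sum,
      List.map_map]
    congr 1
    refine List.map_congr_left fun a _ => ?_
    simp only [Function.comp_apply, map_smul, eval_remap d D hd h2]
  · rw [depthIn_gate_last]
    have hw : prodWeight (Gate.sum (args.map fun a => (a.1, remap O m a.2)) : Gate ℂ σ) = 0 := by
      simp [prodWeight, Gate.isProd]
    rw [hw, Nat.zero_add, Gate.args, List.map_map, List.map_map]
    refine foldr_max_le fun x hx => ?_
    obtain ⟨a, ha, rfl⟩ := List.mem_map.1 hx
    simp only [Function.comp_apply]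
    refine (depthIn_remap_le D h3 a.2).trans ?_
    have := opPD_le_gatePD_of_sum D hg ha
    omega

/-- Case (c): a product gate whose operands have EVEN maximal level is copied with re-mapped
operands. [cite: GuptaKamathKayalSaptharishi2016, §4] -/
theorem step_prod_even (hd : 1 ≤ d) (h : ∀ g ∈ gateValues D.gates, ∃ e : ℕ, g.IsHomogeneous e)
    {m : ℕ} {us : List (Operand ℂ σ)} (hg : D.gates[m]? = some (.prod us))
    (hk : (tv d D m).totalDegree ≠ 0) {M : ℕ} (hM : D.gatePD m = M + 1) (hMe : Even M)
    (Acc : List (Gate ℂ σ)) (O : ℕ → Operand ℂ σ)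
    (h2 : ∀ i < m, (O i).eval (gateValues Acc) = tv d D i)
    (h3 : ∀ i < m, (O i).depthIn (gateWDepths prodWeight Acc) ≤ (D.gatePD i + 1) / 2) :
    ∃ (T : List (Gate ℂ σ)) (new : Operand ℂ σ), new.RefsBelow (Acc ++ T).length ∧
      new.eval (gateValues (Acc ++ T)) = tv d D m ∧
      new.depthIn (gateWDepths prodWeight (Acc ++ T)) ≤ (D.gatePD m + 1) / 2 ∧ T.length ≤ 1 := by
  refine ⟨[Gate.prod (us.map (remap O m))], .gate Acc.length, by simp [Operand.RefsBelow], ?_, ?_,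
    by simp⟩
  · obtain ⟨htv, hne, e, hed, he⟩ := tv_spec d h hk
    rw [gateVal_of_prod D hg] at htv hne he
    rw [eval_gate_last, Gate.eval, List.map_map, htv]
    have hl : us.map ((fun u => Operand.eval (gateValues Acc) u) ∘ remap O m) =
        (us.map (D.opVal m)).map (trunc d) := by
      rw [List.map_map]
      exact List.map_congr_left fun u _ => by
        simp only [Function.comp_apply, eval_remap d D hd h2]
    rw [hl]
    exact trunc_list_prod _ (fun v hv => by
      obtain ⟨u, _, rfl⟩ := List.mem_map.1 hv
      exact opVal_isHomogeneous h m u) he hed hne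
  · rw [depthIn_gate_last]
    have hw : prodWeight (Gate.prod (us.map (remap O m)) : Gate ℂ σ) = 1 := by
      simp [prodWeight, Gate.isProd]
    rw [hw, Gate.args, List.map_map, hM]
    have hmax : ((us.map (Operand.depthIn (gateWDepths prodWeight Acc) ∘ remap O m)).foldr max 0)
        ≤ (M + 1) / 2 := by
      refine foldr_max_le fun x hx => ?_
      obtain ⟨u, hu, rfl⟩ := List.mem_map.1 hx
      simp only [Function.comp_apply]
      refine (depthIn_remap_le D h3 u).trans ?_
      have h' := opPD_succ_le_gatePD_of_prod D hg hu
      rw [hM] at h'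
      exact Nat.div_le_div_right (by omega)
    obtain ⟨k, hk2⟩ := hMe
    omega

variable [Fintype σ] [DecidableEq σ]

/-- The gate count of one even block, as a function of the number `u` of atom monomials.
[cite: GuptaKamathKayalSaptharishi2016, §4] -/
def blockSize (u d : ℕ) : ℕ :=
  (2 ^ d * ((u * 2 ^ d + 1) * d + 1)) * (u * 2 ^ d * (d * d) + 1) + 1

/-- The budget per gate. -/
def perGate (N d : ℕ) : ℕ := 16 * N ^ 2 * 64 ^ d

omit [Fintype σ] [DecidableEq σ] in
/-- The block fits the budget. -/
theorem blockSize_succ_le {u N d : ℕ} (hd : 1 ≤ d) (hN : 2 ≤ N) (hu : u ≤ 2 * N) :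
    blockSize u d + 2 ≤ perGate N d := by
  unfold blockSize perGate
  set a := 2 ^ d with ha
  have ha2 : 2 ≤ a := by
    rw [ha]
    calc (2 : ℕ) = 2 ^ 1 := by norm_num
      _ ≤ 2 ^ d := Nat.pow_le_pow_right (by norm_num) hd
  have hda : d ≤ a := by rw [ha]; exact (Nat.lt_two_pow_self).le
  have h64 : (64 : ℕ) ^ d = a ^ 6 := by
    rw [ha, ← pow_mul, show (64 : ℕ) = 2 ^ 6 by norm_num, ← pow_mul, Nat.mul_comm]
  rw [h64]
  have hA : (u * a + 1) * d + 1 ≤ 3 * N * a ^ 2 := by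
    calc (u * a + 1) * d + 1 ≤ (2 * N * a + 1) * a + 1 := by
          have : (u * a + 1) * d ≤ (2 * N * a + 1) * a :=
            Nat.mul_le_mul (by nlinarith) hda
          omega
      _ = 2 * N * a ^ 2 + a + 1 := by ring
      _ ≤ 3 * N * a ^ 2 := by
          have : a + 1 ≤ a * a := by nlinarith
          have : a * a ≤ N * a ^ 2 := by
            rw [pow_two]; exact Nat.le_mul_of_pos_left _ (by omega)
          nlinarith
  have hB : u * a * (d * d) + 1 ≤ 3 * N * a ^ 3 := by
    calc u * a * (d * d) + 1 ≤ 2 * N * a * (a * a) + 1 := by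
          have : u * a * (d * d) ≤ 2 * N * a * (a * a) :=
            Nat.mul_le_mul (Nat.mul_le_mul_right _ hu) (Nat.mul_le_mul hda hda)
          omega
      _ = 2 * N * a ^ 3 + 1 := by ring
      _ ≤ 3 * N * a ^ 3 := by
          have : 0 < N * a ^ 3 := by positivity
          nlinarith [this]
  calc a * ((u * a + 1) * d + 1) * (u * a * (d * d) + 1) + 1 + 2
      ≤ a * (3 * N * a ^ 2) * (3 * N * a ^ 3) + 3 := by
        have := Nat.mul_le_mul (Nat.mul_le_mul_left a hA) hB
        omega
    _ = 9 * N ^ 2 * a ^ 6 + 3 := by ring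
    _ ≤ 16 * N ^ 2 * a ^ 6 := by
        have : 0 < N ^ 2 * a ^ 6 := by positivity
        nlinarith [this]

omit [Fintype σ] [DecidableEq σ] in
/-- The total budget fits the stated bound with exponent `8`. -/
theorem total_le (N d s : ℕ) (hN : 2 ≤ N) (hs : s ≤ N) :
    s * perGate N d ≤ N ^ 8 * 2 ^ (8 * d) := by
  unfold perGate
  have h1 : (64 : ℕ) ^ d ≤ 2 ^ (8 * d) := by
    rw [pow_mul, show (2 : ℕ) ^ 8 = 256 by norm_num]
    exact Nat.pow_le_pow_left (by norm_num) d
  have h2 : s * (16 * N ^ 2) ≤ N ^ 8 := by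
    calc s * (16 * N ^ 2) ≤ N * (16 * N ^ 2) := Nat.mul_le_mul_right _ hs
      _ = 16 * N ^ 3 := by ring
      _ ≤ N ^ 5 * N ^ 3 := by
          refine Nat.mul_le_mul_right _ ?_
          calc (16 : ℕ) ≤ 2 ^ 5 := by norm_num
            _ ≤ N ^ 5 := Nat.pow_le_pow_left hN 5
      _ = N ^ 8 := by ring
  calc s * (16 * N ^ 2 * 64 ^ d) = s * (16 * N ^ 2) * 64 ^ d := by ring
    _ ≤ N ^ 8 * 2 ^ (8 * d) := Nat.mul_le_mul h2 h1

end Halving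

end Summit.ValiantsHypothesis.ValiantsHypothesis.Theorems.DepthWindow
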